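import Literature.NumberTheory.EllipticCurves.ModThreeFiveImageJLines
import Literature.NumberTheory.EllipticCurves.ThreeTorsionRadicalsPointsProofs
import Literature.NumberTheory.EllipticCurves.TwoAdicImageSurjectivityProofs
import Literature.NumberTheory.EllipticCurves.ComplexMultiplicationHasCMProofs
import Literature.NumberTheory.GaloisRepresentations.AbsGaloisGroup
import HarnessLib

/-!
# A cube discriminant forces a small mod-`3` image: discharge of Zywina's `j`-line criteria at
# `ℓ = 3` (`zywina2015_thm12_not_surjective_three_of_j_eq_J4_holds`, `…_J2_holds`)

Topic `NumberTheory/EllipticCurves`; THEOREMS ONLY (no definition, no named fact, no instance; net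
named-fact debt `−2`): the `Proofs` companion of
`Literature.NumberTheory.EllipticCurves.ModThreeFiveImageJLines`, discharging its two `ℓ = 3` named facts

* `Literature.NumberTheory.EllipticCurves.zywina2015_thm12_not_surjective_three_of_j_eq_J4`
  (Zywina 2015, Thm. 1.2, `G₄ = N_ns(3)`, `J₄(t) = t³`: a non-CM `E/ℚ` with `j(E) = t³` has
  `ρ̄_{E,3}` not surjective), and
* `Literature.NumberTheory.EllipticCurves.zywina2015_thm12_not_surjective_three_of_j_eq_J2`
  (`G₂ = N_s(3)`, `J₂(t) = 27(t+1)³(t−3)³/t³ = (3(t+1)(t−3)/t)³` — a cube, so a corollary).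

## The argument (Serre 1972, §5.3: `ℚ(E[3]) ⊇ ℚ(μ₃, ∛Δ)`)

For an elliptic curve `E` over a field `K` of characteristic `0` the tree's
`ThreeTorsionRadicalsProofs` / `ThreeTorsionRadicalsPointsProofs` give the `x`-coordinates of
`E[3] ∖ O` by radicals: with `ω² + ω + 1 = 0`, `δ³ = Δ`, `U_k² = c₄ − 12ωᵏδ`, `U₀U₁U₂ = c₆`, the four
roots of `Ψ₃` are `x` with `12x + b₂ ∈ {U₀+U₁+U₂, U₀−U₁−U₂, −U₀+U₁−U₂, −U₀−U₁+U₂}`, and the resolvent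
cubic of `Ψ₃/3` is `(θ − b₄/3)³ + Δ/27`: for the two pairs of roots sharing the sign of `U₀`,
`x₁x₂ + x₃x₄ = (b₄ − δ)/3`, the other two pairings giving `(b₄ − ωδ)/3`, `(b₄ − ω²δ)/3`
(`pair_mul_add_pair_mul_eq`, `…_one`, `…_two`). Hence **if `Δ = d³` with `d ∈ K`** (take `δ = d`)
the resolvent root `θ = x₁x₂ + x₃x₄` is `K`-rational, so every `σ ∈ Γ_K` preserves the partition
`{{±T₁, ±T₂}, {±T₃, ±T₄}}` of `E[3] ∖ O` into two pairs of lines. But if `ρ̄_{E,3} : Γ_K → Aut E[3]`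
were onto, a frame `E[3] ≅ 𝔽₃²` (the tree's `nonempty_addEquiv_geomTorsion`, `exists_rep_of_addEquiv`,
`rep_surjective_of_hasSurjectiveModNGaloisRep`) gives `σ` with `σT₁ = T₁`, `σT₂ = T₁ + T₂` (the
shear exists for ANY independent pair — a `decide` over `𝔽₃`), and then `σ` maps `x₂ ↦ x(T₁+T₂)`,
`x(T₁+T₂) ↦ x(T₁−T₂)`, `x(T₁−T₂) ↦ x₂` while `{x(T₁+T₂), x(T₁−T₂)} = {x₃, x₄}` (a `3`-torsion
`x`-coordinate is one of the four radical values, `exists_sign_of_three_smul_eq_zero`, and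
`x(P) = x(Q) ⟹ P = ±Q`), so `σθ ∈ {x₁x₃ + x₂x₄, x₁x₄ + x₂x₃}`, i.e. `(b₄ − δ) = (b₄ − ωδ)` or
`= (b₄ − ω²δ)`: `δ = 0`, contradicting `Δ ≠ 0`. This is
`not_hasSurjectiveModNGaloisRep_three_of_Δ_eq_cube` (any field of characteristic `0`); with
`j = c₄³/Δ`, `j = t³ ≠ 0` gives `Δ = (c₄/t)³` (`…_of_j_eq_cube`), and over `ℚ` a curve with
`j = 0` has CM (the tree's `hasCM_of_j_eq_zero`), whence the two discharges.

What is NOT here: the converse («image in `N_ns(3)` up to conjugacy ⟹ `j` is a cube»), and the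
`ℓ = 5, 7` facts of the same file (`…five_of_j_eq_J4/J9`, `…seven_of_j_eq_J2`), which need the
`5`- and `7`-division fields.

## References

* [Zywina2015] D. Zywina, *On the possible images of the mod ℓ representations associated to
  elliptic curves over ℚ*, arXiv:1508.07660, §1.2 and Theorem 1.2 (second item, `i = 2, 4`).
* [Serre1972] J.-P. Serre, *Propriétés galoisiennes des points d'ordre fini des courbes
  elliptiques*, Invent. Math. 15 (1972), §5.3 (`ℚ(E[3]) ⊃ ℚ(μ₃, ∛Δ)`; the image of `Γ` in
  `PGL₂(𝔽₃) ≅ 𝔖₄` and its quotient `𝔖₃`).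
* [SilvermanAEC2009] J. H. Silverman, *The Arithmetic of Elliptic Curves*, 2nd ed. (2009), III.1
  (`b₂, b₄, c₄ = b₂² − 24b₄`, `j = c₄³/Δ`), Exercise 3.7 (`Ψ₃`), III.7 (`E[3] ≅ (ℤ/3)²`, `ρ̄_{E,3}`).

## Design

Theorems only; namespace `Literature.NumberTheory.EllipticCurves.ModThreeImage` for the internal
steps, the final statements in `Literature.NumberTheory.EllipticCurves` next to the facts they
discharge. Axioms: `propext`, `Classical.choice`, `Quot.sound`.
-/

noncomputable section

open scoped Classical

open Matrix WeierstrassCurve Polynomial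

universe u

namespace Literature.NumberTheory.EllipticCurves.ModThreeImage

open Literature.NumberTheory.EllipticCurves.ThreeTorsionRadicals

/-! ### §1. The shear in `GL₂(𝔽₃)` fixing `v` and sending `w ↦ v + w` (any independent pair) -/

/-- For `(a,b), (c,d) ∈ 𝔽₃²` with `(a,b) ≠ 0` and `(c,d) ∉ {0, ±(a,b)}` there is an invertible
`(p q; r s)` fixing `(a,b)` and mapping `(c,d) ↦ (a+c, b+d)` (exhaustive check). [folklore] -/
private theorem exists_entries_fix_shear :
    ∀ a b c d : ZMod 3, ¬ (a = 0 ∧ b = 0) → ¬ (c = 0 ∧ d = 0) → ¬ (c = a ∧ d = b) →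
      ¬ (c = -a ∧ d = -b) →
      ∃ p q r s : ZMod 3, p * s - q * r ≠ 0 ∧ p * a + q * b = a ∧ r * a + s * b = b ∧
        p * c + q * d = a + c ∧ r * c + s * d = b + d := by
  decide

/-- **The shear**: for `v ≠ 0` and `w ∉ {0, v, −v}` in `𝔽₃²` (i.e. `v, w` a basis) some
`B ∈ GL₂(𝔽₃)` has `Bv = v`, `Bw = v + w`. [folklore] -/
private theorem exists_gl_mulVec_eq (v w : Fin 2 → ZMod 3) (hv : v ≠ 0) (hw : w ≠ 0) (hwv : w ≠ v)
    (hwv' : w ≠ -v) :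
    ∃ B : GL (Fin 2) (ZMod 3), (B : Matrix (Fin 2) (Fin 2) (ZMod 3)) *ᵥ v = v ∧
      (B : Matrix (Fin 2) (Fin 2) (ZMod 3)) *ᵥ w = v + w := by
  haveI : Fact (Nat.Prime 3) := ⟨Nat.prime_three⟩
  have h2 : ∀ u u' : Fin 2 → ZMod 3, u = u' ↔ (u 0 = u' 0 ∧ u 1 = u' 1) := fun u u' ↦
    ⟨fun h ↦ by subst h; exact ⟨rfl, rfl⟩, fun h ↦ funext fun i ↦ by fin_cases i <;> simp [h.1, h.2]⟩
  obtain ⟨p, q, r, s, hdet, h1, h2', h3, h4⟩ := exists_entries_fix_shear (v 0) (v 1) (w 0) (w 1)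
    (fun h ↦ hv ((h2 v 0).mpr h)) (fun h ↦ hw ((h2 w 0).mpr h)) (fun h ↦ hwv ((h2 w v).mpr h))
    (fun h ↦ hwv' ((h2 w (-v)).mpr (by simpa using h)))
  refine ⟨Matrix.GeneralLinearGroup.mkOfDetNeZero !![p, q; r, s]
    (by rw [Matrix.det_fin_two_of]; exact hdet), ?_, ?_⟩
  · funext i
    fin_cases i <;>
      simp [Matrix.GeneralLinearGroup.mkOfDetNeZero, Matrix.mulVec, dotProduct, Fin.sum_univ_two,
        h1, h2']
  · funext i
    fin_cases i <;>
      simp [Matrix.GeneralLinearGroup.mkOfDetNeZero, Matrix.mulVec, dotProduct, Fin.sum_univ_two,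
        h3, h4]

/-! ### §2. Radicals with a prescribed cube root of `Δ` -/

/-- Variant of the tree's `ThreeTorsionRadicals.exists_radicals` with the cube root `δ` of `Δ`
PRESCRIBED: over an algebraically closed field, given `1728Δ = c₄³ − c₆²` and `δ³ = Δ`, there are
`ω` (`ω² + ω + 1 = 0`) and `U₀, U₁, U₂` with `U_k² = c₄ − 12ωᵏδ`, `U₀U₁U₂ = c₆`. [folklore] -/
private theorem exists_radicals_of_pow_three_eq {F : Type*} [Field F] [IsAlgClosed F] (c₄ c₆ Δ δ : F)
    (hc : 1728 * Δ = c₄ ^ 3 - c₆ ^ 2) (hδ : δ ^ 3 = Δ) :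
    ∃ ω U₀ U₁ U₂ : F, ω ^ 2 + ω + 1 = 0 ∧ U₀ ^ 2 = c₄ - 12 * δ ∧
      U₁ ^ 2 = c₄ - 12 * ω * δ ∧ U₂ ^ 2 = c₄ - 12 * ω ^ 2 * δ ∧ U₀ * U₁ * U₂ = c₆ := by
  obtain ⟨ω, hω⟩ : ∃ ω : F, ω ^ 2 + ω + 1 = 0 := by
    have hdeg : (C 1 * X ^ 2 + C 1 * X + C 1 : F[X]).degree = 2 := degree_quadratic one_ne_zero
    obtain ⟨ω, hω⟩ := IsAlgClosed.exists_root (C 1 * X ^ 2 + C 1 * X + C 1 : F[X])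
      (by rw [hdeg]; decide)
    refine ⟨ω, ?_⟩
    have := hω.eq_zero
    simpa using this
  obtain ⟨U₀, hU₀⟩ := IsAlgClosed.exists_pow_nat_eq (c₄ - 12 * δ) (by norm_num : 0 < 2)
  obtain ⟨U₁, hU₁⟩ := IsAlgClosed.exists_pow_nat_eq (c₄ - 12 * ω * δ) (by norm_num : 0 < 2)
  obtain ⟨V₂, hV₂⟩ := IsAlgClosed.exists_pow_nat_eq (c₄ - 12 * ω ^ 2 * δ) (by norm_num : 0 < 2)
  have hprod : (U₀ * U₁ * V₂) ^ 2 = c₆ ^ 2 := by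
    have e := prod_c₄_sub_twelve_mul (c₄ := c₄) (δ := δ) hω
    rw [mul_pow, mul_pow, hU₀, hU₁, hV₂, e, hδ]
    linear_combination -hc
  rcases sq_eq_sq_iff_eq_or_eq_neg.mp hprod with h | h
  · exact ⟨ω, U₀, U₁, V₂, hω, hU₀, hU₁, hV₂, h⟩
  · exact ⟨ω, U₀, U₁, -V₂, hω, hU₀, hU₁, by rw [neg_sq, hV₂], by rw [mul_neg, h, neg_neg]⟩

/-- `ω ≠ 1` and `ω² ≠ 1` and `ω² ≠ ω` for a primitive cube root of unity in characteristic `0`.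
[folklore] -/
private theorem omega_ne {F : Type*} [Field F] [CharZero F] {ω : F} (hω : ω ^ 2 + ω + 1 = 0) :
    ω ≠ 1 ∧ ω ^ 2 ≠ 1 ∧ ω ^ 2 ≠ ω := by
  refine ⟨fun h ↦ ?_, fun h ↦ ?_, fun h ↦ ?_⟩
  · rw [h] at hω
    norm_num at hω
  · have h1 : ω = -2 := by linear_combination hω - h
    rw [h1] at h
    norm_num at h
  · have h1 : (2 * ω + 1) ^ 2 = -3 := by linear_combination 4 * hω
    have h2 : 2 * ω + 1 = 0 := by linear_combination hω - h
    rw [h2] at h1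
    norm_num at h1

/-- The three radicands are pairwise distinct when `δ ≠ 0`: `U₀² ≠ U₁²`, `U₀² ≠ U₂²`, `U₁² ≠ U₂²`,
whence `U_i ± U_j ≠ 0`. [folklore] -/
private theorem radical_sum_ne_zero {F : Type*} [Field F] [CharZero F] {ω δ c₄ U₀ U₁ U₂ : F}
    (hω : ω ^ 2 + ω + 1 = 0) (h₀ : U₀ ^ 2 = c₄ - 12 * δ) (h₁ : U₁ ^ 2 = c₄ - 12 * ω * δ)
    (h₂ : U₂ ^ 2 = c₄ - 12 * ω ^ 2 * δ) (hδ : δ ≠ 0) :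
    U₀ + U₁ ≠ 0 ∧ U₀ - U₁ ≠ 0 ∧ U₀ + U₂ ≠ 0 ∧ U₀ - U₂ ≠ 0 ∧ U₁ + U₂ ≠ 0 ∧ U₁ - U₂ ≠ 0 := by
  obtain ⟨hω1, hω2, hω3⟩ := omega_ne hω
  have h12 : (12 : F) ≠ 0 := by norm_num
  have d01 : (U₀ + U₁) * (U₀ - U₁) = 12 * (ω - 1) * δ := by linear_combination h₀ - h₁
  have d02 : (U₀ + U₂) * (U₀ - U₂) = 12 * (ω ^ 2 - 1) * δ := by linear_combination h₀ - h₂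
  have d12 : (U₁ + U₂) * (U₁ - U₂) = 12 * (ω ^ 2 - ω) * δ := by linear_combination h₁ - h₂
  have n01 : (U₀ + U₁) * (U₀ - U₁) ≠ 0 := by
    rw [d01]; exact mul_ne_zero (mul_ne_zero h12 (sub_ne_zero.mpr hω1)) hδ
  have n02 : (U₀ + U₂) * (U₀ - U₂) ≠ 0 := by
    rw [d02]; exact mul_ne_zero (mul_ne_zero h12 (sub_ne_zero.mpr hω2)) hδ
  have n12 : (U₁ + U₂) * (U₁ - U₂) ≠ 0 := by
    rw [d12]; exact mul_ne_zero (mul_ne_zero h12 (sub_ne_zero.mpr hω3)) hδ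
  exact ⟨left_ne_zero_of_mul n01, right_ne_zero_of_mul n01, left_ne_zero_of_mul n02,
    right_ne_zero_of_mul n02, left_ne_zero_of_mul n12, right_ne_zero_of_mul n12⟩

/-! ### §3. Points of `E(K̄)` and the Galois action on `x`-coordinates -/

variable {K : Type u} [Field K] (V : WeierstrassCurve K)

/-- A non-zero point is an affine point `(x, y)`. [folklore] -/
private theorem exists_eq_some_of_ne_zero {F : Type*} [Field F] {W : WeierstrassCurve F}
    {P : W.toAffine.Point} (hP : P ≠ 0) :
    ∃ (x y : F) (h : W.toAffine.Nonsingular x y), P = Affine.Point.some x y h := by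
  rcases P with _ | ⟨x, y, h⟩
  · exact (hP rfl).elim
  · exact ⟨x, y, h, rfl⟩

/-- `σ ∈ Γ_K` acts on an affine torsion point coordinatewise: `σ • (x, y) = (σx, σy)` (the tree's
action of `Field.absoluteGaloisGroup K` on `K̄`, `AbsGaloisGroup.lean`). [folklore] -/
private theorem coe_smul_eq_some {n : ℤ} (σ : Field.absoluteGaloisGroup K)
    (T : geomTorsion V n) {x y : AlgebraicClosure K}
    {h : (V.baseChange (AlgebraicClosure K)).toAffine.Nonsingular x y}
    (hT : (T : geomPoints V) = Affine.Point.some x y h) :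
    ∃ h', ((σ • T : geomTorsion V n) : geomPoints V) = Affine.Point.some (σ • x) (σ • y) h' := by
  have hval : ((σ • T : geomTorsion V n) : geomPoints V) =
      Affine.Point.map ((Field.absoluteGaloisGroup.toAlgEquiv K σ :
        AlgebraicClosure K ≃ₐ[K] AlgebraicClosure K) : AlgebraicClosure K →ₐ[K] AlgebraicClosure K)
        (T : geomPoints V) := rfl
  rw [hT, Affine.Point.map_some] at hval
  exact ⟨_, hval⟩

/-- Points with the same `x`-coordinate are equal or opposite (in `E[n]`). [folklore] -/
private theorem eq_or_eq_neg_of_X_eq {n : ℤ} {T T' : geomTorsion V n} {x y x' y' : AlgebraicClosure K}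
    {h : (V.baseChange (AlgebraicClosure K)).toAffine.Nonsingular x y}
    {h' : (V.baseChange (AlgebraicClosure K)).toAffine.Nonsingular x' y'}
    (hT : (T : geomPoints V) = Affine.Point.some x y h)
    (hT' : (T' : geomPoints V) = Affine.Point.some x' y' h') (hx : x = x') :
    T = T' ∨ T = -T' := by
  rcases (Affine.Point.X_eq_iff (h₁ := h) (h₂ := h')).mp hx with e | e
  · left
    apply Subtype.ext
    rw [hT, hT']
    exact e
  · right
    apply Subtype.ext
    rw [AddSubgroup.coe_neg, hT, hT']
    exact e

/-- Equal or opposite points have the same `x`-coordinate. [folklore] -/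
private theorem X_eq_of_eq_or_eq_neg {n : ℤ} {T T' : geomTorsion V n} {x y x' y' : AlgebraicClosure K}
    {h : (V.baseChange (AlgebraicClosure K)).toAffine.Nonsingular x y}
    {h' : (V.baseChange (AlgebraicClosure K)).toAffine.Nonsingular x' y'}
    (hT : (T : geomPoints V) = Affine.Point.some x y h)
    (hT' : (T' : geomPoints V) = Affine.Point.some x' y' h') (e : T = T' ∨ T = -T') :
    x = x' := by
  rcases e with e | e
  · have e' := congrArg Subtype.val e
    rw [hT, hT'] at e'
    exact (Affine.Point.some.inj e').1
  · have e' := congrArg Subtype.val e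
    rw [AddSubgroup.coe_neg, hT, hT'] at e'
    have e'' : (Affine.Point.some x y h : (V.baseChange (AlgebraicClosure K)).toAffine.Point) =
        -Affine.Point.some x' y' h' := e'
    rw [Affine.Point.neg_some] at e''
    exact (Affine.Point.some.inj e'').1

/-- In `E[3]`: `T + T + T = 0`. [folklore] -/
private theorem add_add_self_eq_zero (T : geomTorsion V ((3 : ℕ) : ℤ)) : T + T + T = 0 := by
  have h := AddSubgroup.torsionBy.nsmul T
  have e : T + T + T = (3 : ℕ) • T := by abel
  rw [e]
  exact h

variable [CharZero K] [V.IsElliptic]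

/-- The `x`-coordinate of a non-zero point of `E[3]` is one of the four radical values.
[cite: SilvermanAEC2009, Exercise 3.7] -/
private theorem twelve_mul_X_add_b₂_mem {ω δ U₀ U₁ U₂ : AlgebraicClosure K} (hω : ω ^ 2 + ω + 1 = 0)
    (h₀ : U₀ ^ 2 = (V.baseChange (AlgebraicClosure K)).c₄ - 12 * δ)
    (h₁ : U₁ ^ 2 = (V.baseChange (AlgebraicClosure K)).c₄ - 12 * ω * δ)
    (h₂ : U₂ ^ 2 = (V.baseChange (AlgebraicClosure K)).c₄ - 12 * ω ^ 2 * δ)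
    (hp : U₀ * U₁ * U₂ = (V.baseChange (AlgebraicClosure K)).c₆)
    (T : geomTorsion V ((3 : ℕ) : ℤ)) {x y : AlgebraicClosure K}
    {h : (V.baseChange (AlgebraicClosure K)).toAffine.Nonsingular x y}
    (hT : (T : geomPoints V) = Affine.Point.some x y h) :
    12 * x + (V.baseChange (AlgebraicClosure K)).b₂ = U₀ + U₁ + U₂ ∨
      12 * x + (V.baseChange (AlgebraicClosure K)).b₂ = U₀ - U₁ - U₂ ∨
      12 * x + (V.baseChange (AlgebraicClosure K)).b₂ = -U₀ + U₁ - U₂ ∨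
      12 * x + (V.baseChange (AlgebraicClosure K)).b₂ = -U₀ - U₁ + U₂ := by
  have h3 : ((3 : ℕ) : ℤ) • (T : geomPoints V) = 0 := mem_torsionBy_iff.mp T.2
  rw [hT] at h3
  have h3' : (3 : ℤ) • (Affine.Point.some x y h :
      (V.baseChange (AlgebraicClosure K)).toAffine.Point) = 0 := by exact_mod_cast h3
  exact exists_sign_of_three_smul_eq_zero hω h₀ h₁ h₂ hp h h3'

/-! ### §4. The engine: a `K`-rational resolvent root versus the shear -/

/-- **The contradiction.** With radicals `ω, δ, U_k` for `E/K̄` where `δ = d ∈ K`, `δ ≠ 0`, the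
points `T₁ = (x₁, y₁)`, `T₂ = (x₂, y₂)` of `E[3]` with `12x₁ + b₂ = U₀ + U₁ + U₂`,
`12x₂ + b₂ = U₀ − U₁ − U₂`, and `σ ∈ Γ_K` with `σT₁ = T₁`, `σT₂ = T₁ + T₂`: impossible, because
`σ` fixes the `K`-rational `x₁x₂ + x₃x₄ = (b₄ − δ)/3` but moves it to `(b₄ − ωδ)/3` or
`(b₄ − ω²δ)/3`. [cite: Serre1972, §5.3 (ℚ(E[3]) ⊃ ℚ(μ₃, ∛Δ))] -/
private theorem false_of_shear {d : K} {ω δ U₀ U₁ U₂ : AlgebraicClosure K} (hω : ω ^ 2 + ω + 1 = 0)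
    (hδd : δ = algebraMap K (AlgebraicClosure K) d) (hδ : δ ≠ 0)
    (h₀ : U₀ ^ 2 = (V.baseChange (AlgebraicClosure K)).c₄ - 12 * δ)
    (h₁ : U₁ ^ 2 = (V.baseChange (AlgebraicClosure K)).c₄ - 12 * ω * δ)
    (h₂ : U₂ ^ 2 = (V.baseChange (AlgebraicClosure K)).c₄ - 12 * ω ^ 2 * δ)
    (hp : U₀ * U₁ * U₂ = (V.baseChange (AlgebraicClosure K)).c₆)
    (T₁ T₂ : geomTorsion V ((3 : ℕ) : ℤ)) {x₁ y₁ x₂ y₂ : AlgebraicClosure K}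
    {n₁ : (V.baseChange (AlgebraicClosure K)).toAffine.Nonsingular x₁ y₁}
    {n₂ : (V.baseChange (AlgebraicClosure K)).toAffine.Nonsingular x₂ y₂}
    (hT₁ : (T₁ : geomPoints V) = Affine.Point.some x₁ y₁ n₁)
    (hT₂ : (T₂ : geomPoints V) = Affine.Point.some x₂ y₂ n₂)
    (hx₁ : 12 * x₁ + (V.baseChange (AlgebraicClosure K)).b₂ = U₀ + U₁ + U₂)
    (hx₂ : 12 * x₂ + (V.baseChange (AlgebraicClosure K)).b₂ = U₀ - U₁ - U₂)
    (σ : Field.absoluteGaloisGroup K) (hσ₁ : σ • T₁ = T₁) (hσ₂ : σ • T₂ = T₁ + T₂) : False := by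
  obtain ⟨-, -, -, -, u12, -⟩ := radical_sum_ne_zero hω h₀ h₁ h₂ hδ
  have h12 : (12 : AlgebraicClosure K) ≠ 0 := by norm_num
  have h3T := add_add_self_eq_zero V
  -- `x₁ ≠ x₂`, so `T₂ ∉ {0, ±T₁}`, `T₁ ≠ 0`
  have hx12 : x₁ ≠ x₂ := by
    intro e
    apply u12
    linear_combination (-(1 / 2 : AlgebraicClosure K)) * hx₁ + (1 / 2 : AlgebraicClosure K) * hx₂ +
      6 * e
  have hT₁0 : T₁ ≠ 0 := fun e ↦ Affine.Point.some_ne_zero n₁ (by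
    have := congrArg Subtype.val e; rwa [hT₁] at this)
  have hT₂0 : T₂ ≠ 0 := fun e ↦ Affine.Point.some_ne_zero n₂ (by
    have := congrArg Subtype.val e; rwa [hT₂] at this)
  have hT₂1 : ¬ (T₂ = T₁ ∨ T₂ = -T₁) := fun e ↦ hx12 (X_eq_of_eq_or_eq_neg V hT₂ hT₁ e).symm
  -- `S = T₁ + T₂` and `D = T₁ - T₂` are non-zero points `(x_S, y_S)`, `(x_D, y_D)`
  set S := T₁ + T₂ with hS
  set D := T₁ - T₂ with hD
  have hS0 : S ≠ 0 := fun e ↦ hT₂1 (Or.inr (eq_neg_of_add_eq_zero_right e))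
  have hD0 : D ≠ 0 := fun e ↦ hT₂1 (Or.inl (sub_eq_zero.mp e).symm)
  have hS0' : (S : geomPoints V) ≠ 0 := fun e ↦ hS0 (Subtype.ext e)
  have hD0' : (D : geomPoints V) ≠ 0 := fun e ↦ hD0 (Subtype.ext e)
  obtain ⟨xS, yS, nS, hSe⟩ :=
    exists_eq_some_of_ne_zero (W := V.baseChange (AlgebraicClosure K)) hS0'
  obtain ⟨xD, yD, nD, hDe⟩ :=
    exists_eq_some_of_ne_zero (W := V.baseChange (AlgebraicClosure K)) hD0'
  -- their `x`-coordinates avoid `x₁, x₂` and each other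
  have hxS1 : xS ≠ x₁ := by
    intro e
    rcases eq_or_eq_neg_of_X_eq V hSe hT₁ e with e' | e'
    · -- `T₁ + T₂ = T₁` ⟹ `T₂ = 0`
      apply hT₂0
      calc T₂ = S - T₁ := by rw [hS]; abel
        _ = 0 := by rw [e', sub_self]
    · -- `T₁ + T₂ = -T₁` ⟹ `T₂ = -T₁ - T₁ = T₁`
      apply hT₂1; left
      calc T₂ = S - T₁ := by rw [hS]; abel
        _ = -T₁ - T₁ + (T₁ + T₁ + T₁) := by rw [e', h3T T₁, add_zero]
        _ = T₁ := by abel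
  have hxS2 : xS ≠ x₂ := by
    intro e
    rcases eq_or_eq_neg_of_X_eq V hSe hT₂ e with e' | e'
    · -- `T₁ + T₂ = T₂` ⟹ `T₁ = 0`
      apply hT₁0
      calc T₁ = S - T₂ := by rw [hS]; abel
        _ = 0 := by rw [e', sub_self]
    · -- `T₁ + T₂ = -T₂` ⟹ `T₁ = -T₂ - T₂ = T₂`
      apply hT₂1; left
      symm
      calc T₁ = S - T₂ := by rw [hS]; abel
        _ = -T₂ - T₂ + (T₂ + T₂ + T₂) := by rw [e', h3T T₂, add_zero]
        _ = T₂ := by abel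
  have hxD1 : xD ≠ x₁ := by
    intro e
    rcases eq_or_eq_neg_of_X_eq V hDe hT₁ e with e' | e'
    · -- `T₁ - T₂ = T₁` ⟹ `T₂ = 0`
      apply hT₂0
      calc T₂ = T₁ - D := by rw [hD]; abel
        _ = 0 := by rw [e', sub_self]
    · -- `T₁ - T₂ = -T₁` ⟹ `T₂ = T₁ + T₁ = -T₁`
      apply hT₂1; right
      calc T₂ = T₁ - D := by rw [hD]; abel
        _ = T₁ + T₁ + T₁ - T₁ := by rw [e']; abel
        _ = -T₁ := by rw [h3T T₁, zero_sub]
  have hxD2 : xD ≠ x₂ := by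
    intro e
    rcases eq_or_eq_neg_of_X_eq V hDe hT₂ e with e' | e'
    · -- `T₁ - T₂ = T₂` ⟹ `T₁ = T₂ + T₂ = -T₂`
      apply hT₂1; right
      have : T₁ = -T₂ := by
        calc T₁ = D + T₂ := by rw [hD]; abel
          _ = T₂ + T₂ + T₂ - T₂ := by rw [e']; abel
          _ = -T₂ := by rw [h3T T₂, zero_sub]
      rw [this, neg_neg]
    · -- `T₁ - T₂ = -T₂` ⟹ `T₁ = 0`
      apply hT₁0
      calc T₁ = D + T₂ := by rw [hD]; abel
        _ = 0 := by rw [e', neg_add_cancel]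
  have hxSD : xS ≠ xD := by
    intro e
    rcases eq_or_eq_neg_of_X_eq V hSe hDe e with e' | e'
    · -- `T₁ + T₂ = T₁ - T₂` ⟹ `T₂ + T₂ = 0` ⟹ `T₂ = 0`
      apply hT₂0
      calc T₂ = T₂ + T₂ + T₂ - (S - D) := by rw [hS, hD]; abel
        _ = 0 := by rw [h3T T₂, e', sub_self, sub_zero]
    · -- `T₁ + T₂ = -(T₁ - T₂)` ⟹ `T₁ + T₁ = 0` ⟹ `T₁ = 0`
      apply hT₁0
      calc T₁ = T₁ + T₁ + T₁ - (S + D) := by rw [hS, hD]; abel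
        _ = 0 := by rw [h3T T₁, e', neg_add_cancel, sub_zero]
  -- so `12x_S + b₂, 12x_D + b₂` are the two values `-U₀ + U₁ - U₂`, `-U₀ - U₁ + U₂`
  have memS := twelve_mul_X_add_b₂_mem V hω h₀ h₁ h₂ hp S hSe
  have memD := twelve_mul_X_add_b₂_mem V hω h₀ h₁ h₂ hp D hDe
  have ex1 : ∀ {x}, 12 * x + (V.baseChange (AlgebraicClosure K)).b₂ = U₀ + U₁ + U₂ → x = x₁ :=
    fun e ↦ mul_left_cancel₀ h12 (by linear_combination e - hx₁)
  have ex2 : ∀ {x}, 12 * x + (V.baseChange (AlgebraicClosure K)).b₂ = U₀ - U₁ - U₂ → x = x₂ :=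
    fun e ↦ mul_left_cancel₀ h12 (by linear_combination e - hx₂)
  have hcase :
      (12 * xS + (V.baseChange (AlgebraicClosure K)).b₂ = -U₀ + U₁ - U₂ ∧
        12 * xD + (V.baseChange (AlgebraicClosure K)).b₂ = -U₀ - U₁ + U₂) ∨
      (12 * xS + (V.baseChange (AlgebraicClosure K)).b₂ = -U₀ - U₁ + U₂ ∧
        12 * xD + (V.baseChange (AlgebraicClosure K)).b₂ = -U₀ + U₁ - U₂) := by
    rcases memS with e | e | eS | eS
    · exact (hxS1 (ex1 e)).elim
    · exact (hxS2 (ex2 e)).elim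
    all_goals rcases memD with e | e | eD | eD
    · exact (hxD1 (ex1 e)).elim
    · exact (hxD2 (ex2 e)).elim
    · exact (hxSD (mul_left_cancel₀ h12 (by linear_combination eS - eD))).elim
    · exact Or.inl ⟨eS, eD⟩
    · exact (hxD1 (ex1 e)).elim
    · exact (hxD2 (ex2 e)).elim
    · exact Or.inr ⟨eS, eD⟩
    · exact (hxSD (mul_left_cancel₀ h12 (by linear_combination eS - eD))).elim
  -- the action of `σ` on the four `x`-coordinates
  have hσx₁ : σ • x₁ = x₁ := by
    obtain ⟨n', e⟩ := coe_smul_eq_some V σ T₁ hT₁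
    rw [hσ₁, hT₁] at e
    exact (Affine.Point.some.inj e).1.symm
  have hσx₂ : σ • x₂ = xS := by
    obtain ⟨n', e⟩ := coe_smul_eq_some V σ T₂ hT₂
    rw [hσ₂, hSe] at e
    exact (Affine.Point.some.inj e).1.symm
  have hσS : σ • S = -D := by
    rw [hS, smul_add, hσ₁, hσ₂, hD]
    calc T₁ + S = T₁ + T₁ + T₁ - (T₁ - T₂) := by rw [hS]; abel
      _ = -(T₁ - T₂) := by rw [h3T T₁, zero_sub]
  have hσxS : σ • xS = xD := by
    obtain ⟨n', e⟩ := coe_smul_eq_some V σ S hSe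
    rw [hσS, AddSubgroup.coe_neg, hDe] at e
    have e' : (-Affine.Point.some xD yD nD : (V.baseChange (AlgebraicClosure K)).toAffine.Point) =
        Affine.Point.some (σ • xS) (σ • yS) n' := e
    rw [Affine.Point.neg_some] at e'
    exact (Affine.Point.some.inj e').1.symm
  have hσD : σ • D = -T₂ := by
    rw [hD, smul_sub, hσ₁, hσ₂]
    calc T₁ - S = T₁ - (T₁ + T₂) := by rw [hS]
      _ = -T₂ := by abel
  have hσxD : σ • xD = x₂ := by
    obtain ⟨n', e⟩ := coe_smul_eq_some V σ D hDe
    rw [hσD, AddSubgroup.coe_neg, hT₂] at e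
    have e' : (-Affine.Point.some x₂ y₂ n₂ : (V.baseChange (AlgebraicClosure K)).toAffine.Point) =
        Affine.Point.some (σ • xD) (σ • yD) n' := e
    rw [Affine.Point.neg_some] at e'
    exact (Affine.Point.some.inj e').1.symm
  -- the `K`-rational resolvent root `x₁x₂ + x_Sx_D = (b₄ - δ)/3`
  have hb₄ : (V.baseChange (AlgebraicClosure K)).b₄ = algebraMap K (AlgebraicClosure K) V.b₄ :=
    V.map_b₄ _
  have hc₄ : (V.baseChange (AlgebraicClosure K)).c₄ =
      (V.baseChange (AlgebraicClosure K)).b₂ ^ 2 - 24 * (V.baseChange (AlgebraicClosure K)).b₄ :=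
    rfl
  have X1 : 12 * x₁ = U₀ + U₁ + U₂ - (V.baseChange (AlgebraicClosure K)).b₂ := by
    linear_combination hx₁
  have X2 : 12 * x₂ = U₀ - U₁ - U₂ - (V.baseChange (AlgebraicClosure K)).b₂ := by
    linear_combination hx₂
  have hθ : 144 * (x₁ * x₂ + xS * xD) = 48 * ((V.baseChange (AlgebraicClosure K)).b₄ - δ) := by
    have e : 144 * (x₁ * x₂ + xS * xD) = (12 * x₁) * (12 * x₂) + (12 * xS) * (12 * xD) := by ring
    rw [e, X1, X2]
    rcases hcase with ⟨eS, eD⟩ | ⟨eS, eD⟩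
    · rw [show 12 * xS = -U₀ + U₁ - U₂ - (V.baseChange (AlgebraicClosure K)).b₂ by
          linear_combination eS,
        show 12 * xD = -U₀ - U₁ + U₂ - (V.baseChange (AlgebraicClosure K)).b₂ by
          linear_combination eD]
      linear_combination 2 * h₀ - 2 * h₁ - 2 * h₂ - 2 * hc₄ + 24 * δ * hω
    · rw [show 12 * xS = -U₀ - U₁ + U₂ - (V.baseChange (AlgebraicClosure K)).b₂ by
          linear_combination eS,
        show 12 * xD = -U₀ + U₁ - U₂ - (V.baseChange (AlgebraicClosure K)).b₂ by
          linear_combination eD]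
      linear_combination 2 * h₀ - 2 * h₁ - 2 * h₂ - 2 * hc₄ + 24 * δ * hω
  have hθK : x₁ * x₂ + xS * xD = algebraMap K (AlgebraicClosure K) ((V.b₄ - d) / 3) := by
    have h144 : (144 : AlgebraicClosure K) ≠ 0 := by norm_num
    apply mul_left_cancel₀ h144
    rw [hθ, hb₄, hδd, map_div₀, map_sub, map_ofNat]
    field_simp
    ring
  -- `σ` fixes it …
  have hfix : σ • (x₁ * x₂ + xS * xD) = x₁ * x₂ + xS * xD := by
    rw [hθK, Field.absoluteGaloisGroup.smul_def]
    exact (Field.absoluteGaloisGroup.toAlgEquiv K σ).commutes _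
  -- … but moves it to another pairing
  rw [smul_add, smul_mul', smul_mul', hσx₁, hσx₂, hσxS, hσxD] at hfix
  have E : (12 * x₁) * (12 * xS) + (12 * xD) * (12 * x₂) =
      (12 * x₁) * (12 * x₂) + (12 * xS) * (12 * xD) := by linear_combination 144 * hfix
  rw [X1, X2] at E
  obtain ⟨hω1, hω2, -⟩ := omega_ne hω
  have h48 : (48 : AlgebraicClosure K) ≠ 0 := by norm_num
  rcases hcase with ⟨eS, eD⟩ | ⟨eS, eD⟩
  · rw [show 12 * xS = -U₀ + U₁ - U₂ - (V.baseChange (AlgebraicClosure K)).b₂ by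
        linear_combination eS,
      show 12 * xD = -U₀ - U₁ + U₂ - (V.baseChange (AlgebraicClosure K)).b₂ by
        linear_combination eD] at E
    have key : 48 * δ * (1 - ω) = 0 := by linear_combination E - 4 * h₁ + 4 * h₀
    rcases mul_eq_zero.mp key with e | e
    · exact (mul_ne_zero h48 hδ) e
    · exact hω1 (sub_eq_zero.mp e).symm
  · rw [show 12 * xS = -U₀ - U₁ + U₂ - (V.baseChange (AlgebraicClosure K)).b₂ by
        linear_combination eS,
      show 12 * xD = -U₀ + U₁ - U₂ - (V.baseChange (AlgebraicClosure K)).b₂ by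
        linear_combination eD] at E
    have key : 48 * δ * (1 - ω ^ 2) = 0 := by linear_combination E - 4 * h₂ + 4 * h₀
    rcases mul_eq_zero.mp key with e | e
    · exact (mul_ne_zero h48 hδ) e
    · exact hω2 (sub_eq_zero.mp e).symm

/-! ### §5. The main theorem and the discharges -/

/-- **A cube discriminant forces a small mod-`3` image** (Serre 1972, §5.3: `K(E[3]) ⊇ K(μ₃, ∛Δ)`,
and onto `GL₂(𝔽₃)` needs the `𝔖₃`-quotient `Gal(K(μ₃, ∛Δ)/K)` to be all of `𝔖₃`): for an elliptic
curve `E` over a field `K` of characteristic `0` whose discriminant is a cube in `K`, the mod-`3`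
representation `ρ̄_{E,3} : Γ_K → Aut E[3]` is NOT surjective. Proof: frame `E[3] ≅ 𝔽₃²`
(`nonempty_addEquiv_geomTorsion`, `exists_rep_of_addEquiv`); the radical `3`-torsion points
`T₁, T₂` with `12x + b₂ = U₀ + U₁ + U₂`, `U₀ − U₁ − U₂` (`three_smul_eq_zero_of_twelve_mul_add_eq`)
are independent; surjectivity (`rep_surjective_of_hasSurjectiveModNGaloisRep`) realises the shear
`T₁ ↦ T₁, T₂ ↦ T₁ + T₂` by some `σ ∈ Γ_K`, contradicting `false_of_shear`.
[cite: Serre1972, §5.3 (the image of Γ in PGL₂(𝔽₃) ≅ 𝔖₄; ℚ(E[3]) ⊃ ℚ(μ₃, ∛Δ))] -/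
theorem not_hasSurjectiveModNGaloisRep_three_of_Δ_eq_cube {d : K} (hd : V.Δ = d ^ 3) :
    ¬ V.HasSurjectiveModNGaloisRep 3 := by
  intro hs
  haveI : Fact (Nat.Prime 3) := ⟨Nat.prime_three⟩
  have h3K : ((3 : ℕ) : K) ≠ 0 := by norm_num
  -- frame, matrix representation, onto
  obtain ⟨e⟩ := nonempty_addEquiv_geomTorsion V 3 1 le_rfl h3K
  have e' : geomTorsion V ((3 : ℕ) : ℤ) ≃+ (Fin 2 → ZMod 3) := e
  obtain ⟨ρ, hρ⟩ := exists_rep_of_addEquiv V e'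
  have hs' : V.HasSurjectiveModNGaloisRep ((3 : ℕ) : ℤ) := by exact_mod_cast hs
  have hρs := rep_surjective_of_hasSurjectiveModNGaloisRep V e' ρ hρ hs'
  -- radicals over `K̄` with `δ = d`
  have hΔ' : (algebraMap K (AlgebraicClosure K) d) ^ 3 = (V.baseChange (AlgebraicClosure K)).Δ := by
    rw [← map_pow, ← hd]
    exact (V.map_Δ _).symm
  obtain ⟨ω, U₀, U₁, U₂, hω, h₀, h₁, h₂, hp⟩ := exists_radicals_of_pow_three_eq
    (V.baseChange (AlgebraicClosure K)).c₄ (V.baseChange (AlgebraicClosure K)).c₆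
    (V.baseChange (AlgebraicClosure K)).Δ (algebraMap K (AlgebraicClosure K) d)
    (V.baseChange (AlgebraicClosure K)).c_relation hΔ'
  have hδ0 : algebraMap K (AlgebraicClosure K) d ≠ 0 := by
    intro h0
    apply (V.baseChange (AlgebraicClosure K)).Δ'.ne_zero
    rw [(V.baseChange (AlgebraicClosure K)).coe_Δ', ← hΔ', h0]
    ring
  -- the two points `T₁ = (x₁, y₁)`, `T₂ = (x₂, y₂)` of order `3`
  have h12 : (12 : AlgebraicClosure K) ≠ 0 := by norm_num
  obtain ⟨x₁, hx₁⟩ : ∃ x₁ : AlgebraicClosure K,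
      12 * x₁ + (V.baseChange (AlgebraicClosure K)).b₂ = U₀ + U₁ + U₂ :=
    ⟨(U₀ + U₁ + U₂ - (V.baseChange (AlgebraicClosure K)).b₂) / 12, by field_simp; ring⟩
  obtain ⟨x₂, hx₂⟩ : ∃ x₂ : AlgebraicClosure K,
      12 * x₂ + (V.baseChange (AlgebraicClosure K)).b₂ = U₀ - U₁ - U₂ :=
    ⟨(U₀ - U₁ - U₂ - (V.baseChange (AlgebraicClosure K)).b₂) / 12, by field_simp; ring⟩
  obtain ⟨y₁, hy₁⟩ := (V.baseChange (AlgebraicClosure K)).exists_equation x₁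
  obtain ⟨y₂, hy₂⟩ := (V.baseChange (AlgebraicClosure K)).exists_equation x₂
  have n₁ : (V.baseChange (AlgebraicClosure K)).toAffine.Nonsingular x₁ y₁ :=
    (Affine.equation_iff_nonsingular (W := (V.baseChange (AlgebraicClosure K)).toAffine)).mp hy₁
  have n₂ : (V.baseChange (AlgebraicClosure K)).toAffine.Nonsingular x₂ y₂ :=
    (Affine.equation_iff_nonsingular (W := (V.baseChange (AlgebraicClosure K)).toAffine)).mp hy₂
  have h3P₁ : (3 : ℤ) • (Affine.Point.some x₁ y₁ n₁ :
      (V.baseChange (AlgebraicClosure K)).toAffine.Point) = 0 :=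
    three_smul_eq_zero_of_twelve_mul_add_eq hω h₀ h₁ h₂ hp n₁ hx₁
  have h3P₂ : (3 : ℤ) • (Affine.Point.some x₂ y₂ n₂ :
      (V.baseChange (AlgebraicClosure K)).toAffine.Point) = 0 :=
    three_smul_eq_zero_of_twelve_mul_add_eq (U₁ := -U₁) (U₂ := -U₂) hω h₀
      (by rw [neg_sq]; exact h₁) (by rw [neg_sq]; exact h₂) (by linear_combination hp) n₂
      (by rw [hx₂]; ring)
  have m₁ : (Affine.Point.some x₁ y₁ n₁ : geomPoints V) ∈ geomTorsion V ((3 : ℕ) : ℤ) :=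
    mem_torsionBy_iff.mpr (by exact_mod_cast h3P₁)
  have m₂ : (Affine.Point.some x₂ y₂ n₂ : geomPoints V) ∈ geomTorsion V ((3 : ℕ) : ℤ) :=
    mem_torsionBy_iff.mpr (by exact_mod_cast h3P₂)
  set T₁ : geomTorsion V ((3 : ℕ) : ℤ) := ⟨_, m₁⟩ with hT₁eq
  set T₂ : geomTorsion V ((3 : ℕ) : ℤ) := ⟨_, m₂⟩ with hT₂eq
  have hT₁ : (T₁ : geomPoints V) = Affine.Point.some x₁ y₁ n₁ := rfl
  have hT₂ : (T₂ : geomPoints V) = Affine.Point.some x₂ y₂ n₂ := rfl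
  -- `T₁ ≠ 0`, `T₂ ∉ {0, ±T₁}` (the `x`-coordinates differ)
  obtain ⟨-, -, -, -, u12, -⟩ := radical_sum_ne_zero hω h₀ h₁ h₂ hδ0
  have hx12 : x₁ ≠ x₂ := by
    intro e
    apply u12
    linear_combination (-(1 / 2 : AlgebraicClosure K)) * hx₁ + (1 / 2 : AlgebraicClosure K) * hx₂ +
      6 * e
  have hT₁0 : T₁ ≠ 0 := fun e ↦ Affine.Point.some_ne_zero n₁ (congrArg Subtype.val e)
  have hT₂0 : T₂ ≠ 0 := fun e ↦ Affine.Point.some_ne_zero n₂ (congrArg Subtype.val e)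
  have hT₂1 : T₂ ≠ T₁ := fun e ↦ hx12 (X_eq_of_eq_or_eq_neg V hT₂ hT₁ (Or.inl e)).symm
  have hT₂1' : T₂ ≠ -T₁ := fun e ↦ hx12 (X_eq_of_eq_or_eq_neg V hT₂ hT₁ (Or.inr e)).symm
  -- the shear in the frame, realised by some `σ`
  have hv : e' T₁ ≠ 0 := fun h ↦ hT₁0 (e'.injective (by rw [h, map_zero]))
  have hw : e' T₂ ≠ 0 := fun h ↦ hT₂0 (e'.injective (by rw [h, map_zero]))
  have hwv : e' T₂ ≠ e' T₁ := fun h ↦ hT₂1 (e'.injective h)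
  have hwv' : e' T₂ ≠ -e' T₁ := fun h ↦ hT₂1' (e'.injective (by rw [h, map_neg]))
  obtain ⟨B, hB₁, hB₂⟩ := exists_gl_mulVec_eq (e' T₁) (e' T₂) hv hw hwv hwv'
  obtain ⟨σ, hσ⟩ := hρs B
  have hσ₁ : σ • T₁ = T₁ := e'.injective (by rw [hρ, hσ, hB₁])
  have hσ₂ : σ • T₂ = T₁ + T₂ := e'.injective (by rw [hρ, hσ, hB₂, map_add])
  exact false_of_shear V hω rfl hδ0 h₀ h₁ h₂ hp T₁ T₂ hT₁ hT₂ hx₁ hx₂ σ hσ₁ hσ₂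

/-- **`j(E)` a non-zero cube ⟹ `ρ̄_{E,3}` not surjective** (any field of characteristic `0`):
`j = c₄³/Δ`, so `j = t³ ≠ 0` gives `Δ = (c₄/t)³`. [cite: Serre1972, §5.3 (ℚ(E[3]) ⊃ ℚ(μ₃, ∛Δ))]
[cite: SilvermanAEC2009, III.1 (j = c₄³/Δ)] -/
theorem not_hasSurjectiveModNGaloisRep_three_of_j_eq_cube {t : K} (hj0 : V.j ≠ 0)
    (hj : V.j = t ^ 3) : ¬ V.HasSurjectiveModNGaloisRep 3 := by
  have ht : t ≠ 0 := by
    rintro rfl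
    exact hj0 (by rw [hj]; ring)
  have hjΔ : V.j * V.Δ = V.c₄ ^ 3 := by
    rw [WeierstrassCurve.j, ← V.coe_Δ', mul_comm, ← mul_assoc, Units.mul_inv, one_mul]
  have hd : V.Δ = (V.c₄ / t) ^ 3 := by
    rw [div_pow, ← hj, eq_div_iff hj0, mul_comm]
    exact hjΔ
  exact not_hasSurjectiveModNGaloisRep_three_of_Δ_eq_cube V hd

end Literature.NumberTheory.EllipticCurves.ModThreeImage

namespace Literature.NumberTheory.EllipticCurves

open Literature.NumberTheory.EllipticCurves.ModThreeImage

/-- **Over `ℚ`: a non-CM curve with `j = t³` has `ρ̄_{E,3}` not surjective** — Zywina 2015,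
Theorem 1.2, the «if» direction for `G₄ = N_ns(3)` (`J₄(t) = t³`) weakened to non-surjectivity
(`N_ns(3)` has index `3`): a curve with `j = 0` has CM (the tree's `hasCM_of_j_eq_zero`), so
`j ≠ 0` and `not_hasSurjectiveModNGaloisRep_three_of_j_eq_cube` applies.
[cite: Zywina2015, Thm. 1.2 (second item, i = 4) and §1.2 (G₄ = N_ns(3), J₄(t) = t³)] -/
theorem not_hasSurjectiveModNGaloisRep_three_of_not_hasCM_of_j_eq_cube (W : WeierstrassCurve ℚ)
    [W.IsElliptic] (hCM : ¬ W.HasCM) {t : ℚ} (hj : W.j = t ^ 3) :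
    ¬ W.HasSurjectiveModNGaloisRep 3 :=
  not_hasSurjectiveModNGaloisRep_three_of_j_eq_cube W (fun h0 ↦ hCM (hasCM_of_j_eq_zero W h0)) hj

/-- **Discharge of `zywina2015_thm12_not_surjective_three_of_j_eq_J4`** (Zywina 2015, Thm. 1.2,
`i = 4`: `G₄ = N_ns(3)`, `J₄(t) = t³`; the named fact of `ModThreeFiveImageJLines.lean`).
[cite: Zywina2015, Thm. 1.2 (second item, i = 4) and §1.2 (G₄ = N_ns(3), J₄) (arXiv:1508.07660 pp. 3–4)] -/
theorem zywina2015_thm12_not_surjective_three_of_j_eq_J4_holds :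
    zywina2015_thm12_not_surjective_three_of_j_eq_J4 := by
  intro W _ hCM t hj
  exact not_hasSurjectiveModNGaloisRep_three_of_not_hasCM_of_j_eq_cube W hCM hj

/-- **Discharge of `zywina2015_thm12_not_surjective_three_of_j_eq_J2`** (Zywina 2015, Thm. 1.2,
`i = 2`: `G₂ = N_s(3)`, `J₂(t) = 27(t+1)³(t−3)³/t³`): `J₂(t) = (3(t+1)(t−3)/t)³` is a cube, so this
is the case `j = s³` of the previous theorem (consistently with `N_s(3)` lying in a conjugate of the
`2`-Sylow subgroup `N_ns(3)` of `GL₂(𝔽₃)`).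
[cite: Zywina2015, Thm. 1.2 (second item, i = 2) and §1.2 (G₂ = N_s(3), J₂) (arXiv:1508.07660 pp. 3–4)] -/
theorem zywina2015_thm12_not_surjective_three_of_j_eq_J2_holds :
    zywina2015_thm12_not_surjective_three_of_j_eq_J2 := by
  intro W _ hCM t ht hj
  apply not_hasSurjectiveModNGaloisRep_three_of_not_hasCM_of_j_eq_cube W hCM
    (t := 3 * (t + 1) * (t - 3) / t)
  rw [div_pow, eq_div_iff (pow_ne_zero 3 ht)]
  linear_combination hj

end Literature.NumberTheory.EllipticCurves
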